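import Summits.Ventures.LatticeQCDFlow.Scaling.HubChainStartContentDeficitResidual

/-!
HONEST FRAMING: exact (Metropolis-corrected) sampling algorithms for lattice gauge theory; figures
of merit are autocorrelation/cost numbers at stated couplings and volumes; no continuum-physics
claim.

# HubChainStartContentDeficitBudget — THE DISCOUNTED START-CONTENT DEFICIT IS AN EXPLICIT ODD-POWER GEOMETRIC SUM: `Σ_n (1−σ)σⁿ·e⁺_{n+1} ≤ (1−σ)·γ·σq/(1−σ²q²)` WITH
# `q = max{0,−β^X_i} ≤ c` AT A DEEP START WITH THREE PARTICLES (FILE 1), AND `≤ (1−σ)·(α_X/(1+α_X))·σc²/(1−σ²c²)` IN THE RESIDUAL CONFIGURATION (FILE 2)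
# (lean-2 GEN-41, ours)

Venture-side (OURS).  Cell `lqcd-flow` (pub-lqcd), unit `pub-lqcd-lean-2-g41`, 2026-08-30.  Chapter AA (route (β), the cost side), file 3.  Route (β) of OPEN-MATH (b′) weighs the
`j`-attempt laws with `w_j = (1−σ)σʲ⁻¹` (MEMO-gen39∕40; C1–C4); the only negative term of the per-attempt certificate is `L·D`, `D = Σ_j w_j e_j⁺` the discounted start-content
deficit (Z8).  Files 1–2 make `e_n⁺` vanish at odd `n` and decay geometrically at even `n`; summing (§1: `(1−t²)Σ_{n<J, n odd}tⁿ = t − t^{J+[J even]}`, `budget_oddGeom_eq`∕`_le`; the even-power twins `budget_evenGeom_eq`∕`_le` serve file 9):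

* **`sharp_deficit_discounted`** (three particles at ranks `≤ i`, `s < i`): `Σ_{n<J}(1−σ)σⁿ·max{0,e_{n+1}} ≤ (1−σ)(β^X_i−β^Y_i)·σq/(1−(σq)²)`, `q = max{0,−β^X_i}` (`≤ c ≤ ½`);
* **`residual_deficit_discounted`** (tag alone at rank `0`, start alone at rank `1`, `cM_0 = 1+c`): `Σ_{n<J}(1−σ)σⁿ·max{0,e_{n+1}} ≤ (1−σ)·(α_X/(1+α_X))·c·σc/(1−(σc)²)`,
  `α_X = ρ^X_0/ρ_1`.

For the star (`c = 1/K`): `D ≤ (1−σ)σ·γ|β^X_ζ|/(1−σ²(β^X_ζ)²)` with `γ|β^X_ζ| ≤ (1−acc(ζ,a))acc(ζ,a)/K²` (regime A), resp. `D ≤ (1−σ)σ·acc(ζ,a)/((1+acc(ζ,a))(K²−σ²))` (regime B): in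
both regimes the whole discounted deficit is `O((1−σ)σ·acc(ζ,a)/K²)`, the scale of ONE step of `X`'s ★-income `(K+M)x_1(★) = (K+M)acc(ζ,a)/K` times `(1−σ)σ/K` — the quantity the
cost-side inequality must compare it with (memo MEMO-gen41 §3; toy margin ≥ 0.19 in regime A).  Literature grade (cell rule): OWN, elementary; nothing cited; no new bib keys.
-/

open Finset

namespace Summit.Ventures.LatticeQCDFlow.Scaling

/-! ### §1 Odd-power geometric sums -/
section OddGeom

/-- `(1 − t²)·Σ_{n<J, n odd} tⁿ = t − t^{J + [J even]}`. [ours] -/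
theorem budget_oddGeom_eq (t : ℝ) (J : ℕ) :
    (1 - t ^ 2) * ∑ n ∈ range J, (if Odd n then t ^ n else 0) = t - t ^ (J + if Even J then 1 else 0) := by
  induction J with
  | zero => simp
  | succ J ih =>
      rw [sum_range_succ, mul_add, ih]
      rcases Nat.even_or_odd J with he | ho
      · have hno : ¬ Odd J := Nat.not_odd_iff_even.mpr he
        have hne : ¬ Even (J + 1) := Nat.not_even_iff_odd.mpr he.add_one
        rw [if_neg hno, if_pos he, if_neg hne]; ring
      · have hne : ¬ Even J := Nat.not_even_iff_odd.mpr ho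
        have he1 : Even (J + 1) := ho.add_one
        rw [if_pos ho, if_neg hne, if_pos he1]; ring

/-- **`Σ_{n<J, n odd} tⁿ ≤ t/(1 − t²)`** for `0 ≤ t < 1`. [ours] -/
theorem budget_oddGeom_le {t : ℝ} (ht : 0 ≤ t) (ht1 : t < 1) (J : ℕ) :
    ∑ n ∈ range J, (if Odd n then t ^ n else 0) ≤ t / (1 - t ^ 2) := by
  have h1 : 0 < 1 - t ^ 2 := by nlinarith
  rw [le_div_iff₀ h1, mul_comm, budget_oddGeom_eq]
  linarith [pow_nonneg ht (J + if Even J then 1 else 0)]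

/-- `(1 − t²)·Σ_{n<J, n even} tⁿ = 1 − t^{J + [J odd]}`. [ours] -/
theorem budget_evenGeom_eq (t : ℝ) (J : ℕ) :
    (1 - t ^ 2) * ∑ n ∈ range J, (if Even n then t ^ n else 0) = 1 - t ^ (J + if Odd J then 1 else 0) := by
  induction J with
  | zero => simp
  | succ J ih =>
      rw [sum_range_succ, mul_add, ih]
      rcases Nat.even_or_odd J with he | ho
      · have hno : ¬ Odd J := Nat.not_odd_iff_even.mpr he
        have hod1 : Odd (J + 1) := he.add_one
        rw [if_pos he, if_neg hno, if_pos hod1]; ring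
      · have hne : ¬ Even J := Nat.not_even_iff_odd.mpr ho
        have hne1 : ¬ Odd (J + 1) := Nat.not_odd_iff_even.mpr ho.add_one
        rw [if_neg hne, if_pos ho, if_neg hne1]; ring

/-- `Σ_{n<J, n even} tⁿ ≤ 1/(1 − t²)` for `0 ≤ t < 1`. [ours] -/
theorem budget_evenGeom_le {t : ℝ} (ht : 0 ≤ t) (ht1 : t < 1) (J : ℕ) :
    ∑ n ∈ range J, (if Even n then t ^ n else 0) ≤ 1 / (1 - t ^ 2) := by
  have h1 : 0 < 1 - t ^ 2 := by nlinarith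
  rw [le_div_iff₀ h1, mul_comm, budget_evenGeom_eq]
  linarith [pow_nonneg ht (J + if Odd J then 1 else 0)]

/-- The weighted form: `Σ_{n<J} σⁿ·[n odd]·qⁿ·C ≤ C·σq/(1−(σq)²)` for `C ≥ 0`, `0 ≤ σq < 1`. [ours] -/
theorem budget_weighted_le {σ q C : ℝ} (hσ : 0 ≤ σ) (hq : 0 ≤ q) (hσq : σ * q < 1) (hC : 0 ≤ C) (J : ℕ) :
    ∑ n ∈ range J, σ ^ n * (if Odd n then C * q ^ n else 0) ≤ C * (σ * q / (1 - (σ * q) ^ 2)) := by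
  have e : ∑ n ∈ range J, σ ^ n * (if Odd n then C * q ^ n else 0) = C * ∑ n ∈ range J, (if Odd n then (σ * q) ^ n else 0) := by
    rw [mul_sum]
    refine sum_congr rfl fun n _ => ?_
    split_ifs
    · rw [mul_pow]; ring
    · ring
  rw [e]
  exact mul_le_mul_of_nonneg_left (budget_oddGeom_le (mul_nonneg hσ hq) hσq J) hC

end OddGeom

/-! ### §2 The discounted deficit at a deep start with three particles -/
section BudgetA
variable {m s : ℕ} {ρX ρY N RX RY M βX βY a : ℕ → ℝ} {c : ℝ} {PX PY fX fY : ℕ → ℕ → ℝ} {PnX PnY : ℕ → ℕ → ℕ → ℝ} {TX TY : ℕ → ℕ → ℝ}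

/-- **THE DISCOUNTED START-CONTENT DEFICIT (three particles at ranks `≤ i`):** `Σ_{n<J}(1−σ)σⁿ·max{0,e_{n+1}} ≤ (1−σ)·(β^X_i − β^Y_i)·σq/(1−(σq)²)`, `q = max{0,−β^X_i}`. [ours] -/
theorem sharp_deficit_discounted (hρX : ∀ i, 0 < ρX i) (hmonoX : Monotone ρX) (hρY : ∀ i, 0 < ρY i) (hmonoY : Monotone ρY)
    (hagree : ∀ i, i ≠ s → ρX i = ρY i) (htag : ρX s ≤ ρY s) (hN : ∀ i, 0 < N i)
    (hRX : ∀ k, RX k = ∑ i ∈ range k, N i * ρX i) (hRY : ∀ k, RY k = ∑ i ∈ range k, N i * ρY i) (hM : ∀ k, M k = ∑ i ∈ Ico k m, N i)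
    (hPXoff : ∀ i j, i ≠ j → PX i j = c * N j * min 1 (ρX j / ρX i)) (hPXdiag : ∀ i, PX i i = 1 - ∑ j ∈ (range m).erase i, PX i j)
    (hPYoff : ∀ i j, i ≠ j → PY i j = c * N j * min 1 (ρY j / ρY i)) (hPYdiag : ∀ i, PY i i = 1 - ∑ j ∈ (range m).erase i, PY i j)
    (hfX : ∀ k i, fX k i = if i < k then ρX k else if i = k then -(RX k / N k) else 0)
    (hfY : ∀ k i, fY k i = if i < k then ρY k else if i = k then -(RY k / N k) else 0)
    (hβX : ∀ k, βX k = 1 - c * (M k + RX k / ρX k)) (hβY : ∀ k, βY k = 1 - c * (M k + RY k / ρY k)) (ha : ∀ l, a l = 1 - c * M (l + 1))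
    (hPX0 : ∀ i j, PnX 0 i j = if i = j then 1 else 0) (hPXs : ∀ n i j, PnX (n + 1) i j = ∑ l ∈ range m, PnX n i l * PX l j)
    (hPY0 : ∀ i j, PnY 0 i j = if i = j then 1 else 0) (hPYs : ∀ n i j, PnY (n + 1) i j = ∑ l ∈ range m, PnY n i l * PY l j)
    (hTX : ∀ n j, TX n j = (1 - βX j ^ n) / RX m + ∑ k ∈ Ico (j + 1) m, (1 / RX k - 1 / RX (k + 1)) * (βX k ^ n - βX j ^ n))
    (hTY : ∀ n j, TY n j = (1 - βY j ^ n) / RY m + ∑ k ∈ Ico (j + 1) m, (1 / RY k - 1 / RY (k + 1)) * (βY k ^ n - βY j ^ n))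
    (hc : 0 ≤ c) (hcK : c * M 0 ≤ 1 + c) {i : ℕ} (hsi : s < i) (hi : i < m) (h3 : M (i + 1) + 3 ≤ M 0) (hNi : 1 ≤ N i)
    {σ : ℝ} (hσ0 : 0 ≤ σ) (hσ1 : σ ≤ 1) (J : ℕ) :
    ∑ n ∈ range J, (1 - σ) * σ ^ n * max 0 (PnY (n + 1) i i - PnX (n + 1) i i)
      ≤ (1 - σ) * ((βX i - βY i) * (σ * max 0 (-βX i) / (1 - (σ * max 0 (-βX i)) ^ 2))) := by
  set q := max 0 (-βX i) with hq
  have hq0 : 0 ≤ q := le_max_left _ _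
  have hγ := sharp_gamma_nonneg hρY hagree htag hN hRX hRY hβX hβY hc hsi
  -- `q ≤ c ≤ 1/2`
  have hqc : q ≤ c := (sharp_gamma_le hρX hmonoX hN hagree hRX hRY hM hβX hβY hc hcK hsi hi).2
  have hM0 : 0 ≤ M (i + 1) := by rw [hM]; exact sum_nonneg fun l _ => (hN l).le
  have hc2 : c ≤ 1 / 2 := by nlinarith
  have hσq : σ * q < 1 := by nlinarith
  -- termwise
  have hterm : ∀ n, max 0 (PnY (n + 1) i i - PnX (n + 1) i i) ≤ (if Odd n then (βX i - βY i) * q ^ n else 0) := by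
    intro n
    rcases Nat.even_or_odd n with he | ho
    · rw [if_neg (Nat.not_odd_iff_even.mpr he)]
      have h := sharp_deficit_odd hρX hmonoX hρY hmonoY hagree htag hN hRX hRY hM hPXoff hPXdiag hPYoff hPYdiag hfX hfY hβX hβY ha hPX0 hPXs hPY0 hPYs hTX hTY
        hc hcK he.add_one hsi hi h3
      exact max_le le_rfl h
    · rw [if_pos ho]
      have h := sharp_deficit_even hρX hmonoX hρY hmonoY hagree htag hN hRX hRY hM hPXoff hPXdiag hPYoff hPYdiag hfX hfY hβX hβY ha hPX0 hPXs hPY0 hPYs hTX hTY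
        hc hcK ho hsi hi h3 hNi
      exact max_le (mul_nonneg hγ (pow_nonneg hq0 n)) h
  calc ∑ n ∈ range J, (1 - σ) * σ ^ n * max 0 (PnY (n + 1) i i - PnX (n + 1) i i)
      ≤ ∑ n ∈ range J, (1 - σ) * (σ ^ n * (if Odd n then (βX i - βY i) * q ^ n else 0)) := by
        refine sum_le_sum fun n _ => ?_
        rw [mul_assoc]
        exact mul_le_mul_of_nonneg_left (mul_le_mul_of_nonneg_left (hterm n) (pow_nonneg hσ0 n)) (by linarith)
    _ = (1 - σ) * ∑ n ∈ range J, σ ^ n * (if Odd n then (βX i - βY i) * q ^ n else 0) := by rw [mul_sum]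
    _ ≤ (1 - σ) * ((βX i - βY i) * (σ * q / (1 - (σ * q) ^ 2))) :=
        mul_le_mul_of_nonneg_left (budget_weighted_le hσ0 hq0 hσq hγ J) (by linarith)

end BudgetA

/-! ### §3 The discounted deficit in the residual configuration -/
section BudgetB
variable {m : ℕ} {ρX ρY N RX RY M βX βY a : ℕ → ℝ} {c : ℝ} {PX PY fX fY : ℕ → ℕ → ℝ} {PnX PnY : ℕ → ℕ → ℕ → ℝ} {TX TY : ℕ → ℕ → ℝ}

/-- **THE DISCOUNTED START-CONTENT DEFICIT (residual configuration):** `Σ_{n<J}(1−σ)σⁿ·max{0,e_{n+1}} ≤ (1−σ)·(α_X/(1+α_X))·c·(σc/(1−(σc)²))`, `α_X = ρ^X_0/ρ_1`. [ours] -/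
theorem residual_deficit_discounted (hρX : ∀ i, 0 < ρX i) (hmonoX : Monotone ρX) (hρY : ∀ i, 0 < ρY i) (hmonoY : Monotone ρY)
    (hagree : ∀ i, i ≠ 0 → ρX i = ρY i) (htag : ρX 0 ≤ ρY 0) (hN : ∀ i, 0 < N i) (hNge : ∀ i, 1 ≤ N i)
    (hRX : ∀ k, RX k = ∑ i ∈ range k, N i * ρX i) (hRY : ∀ k, RY k = ∑ i ∈ range k, N i * ρY i) (hM : ∀ k, M k = ∑ i ∈ Ico k m, N i)
    (hPXoff : ∀ i j, i ≠ j → PX i j = c * N j * min 1 (ρX j / ρX i)) (hPXdiag : ∀ i, PX i i = 1 - ∑ j ∈ (range m).erase i, PX i j)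
    (hPYoff : ∀ i j, i ≠ j → PY i j = c * N j * min 1 (ρY j / ρY i)) (hPYdiag : ∀ i, PY i i = 1 - ∑ j ∈ (range m).erase i, PY i j)
    (hfX : ∀ k i, fX k i = if i < k then ρX k else if i = k then -(RX k / N k) else 0)
    (hfY : ∀ k i, fY k i = if i < k then ρY k else if i = k then -(RY k / N k) else 0)
    (hβX : ∀ k, βX k = 1 - c * (M k + RX k / ρX k)) (hβY : ∀ k, βY k = 1 - c * (M k + RY k / ρY k)) (ha : ∀ l, a l = 1 - c * M (l + 1))
    (hPX0 : ∀ i j, PnX 0 i j = if i = j then 1 else 0) (hPXs : ∀ n i j, PnX (n + 1) i j = ∑ l ∈ range m, PnX n i l * PX l j)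
    (hPY0 : ∀ i j, PnY 0 i j = if i = j then 1 else 0) (hPYs : ∀ n i j, PnY (n + 1) i j = ∑ l ∈ range m, PnY n i l * PY l j)
    (hTX : ∀ n j, TX n j = (1 - βX j ^ n) / RX m + ∑ k ∈ Ico (j + 1) m, (1 / RX k - 1 / RX (k + 1)) * (βX k ^ n - βX j ^ n))
    (hTY : ∀ n j, TY n j = (1 - βY j ^ n) / RY m + ∑ k ∈ Ico (j + 1) m, (1 / RY k - 1 / RY (k + 1)) * (βY k ^ n - βY j ^ n))
    (hc : 0 ≤ c) (hc1 : c ≤ 1) (hcK : c * M 0 = 1 + c) (hN0 : N 0 = 1) (hN1 : N 1 = 1) (hm : 1 < m)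
    {σ : ℝ} (hσ0 : 0 ≤ σ) (hσ1 : σ < 1) (J : ℕ) :
    ∑ n ∈ range J, (1 - σ) * σ ^ n * max 0 (PnY (n + 1) 1 1 - PnX (n + 1) 1 1)
      ≤ (1 - σ) * ((ρX 0 / ρX 1) / (1 + ρX 0 / ρX 1) * c * (σ * c / (1 - (σ * c) ^ 2))) := by
  set α := ρX 0 / ρX 1 with hα
  have hα0 : 0 ≤ α := div_nonneg (hρX 0).le (hρX 1).le
  have hA : 0 ≤ α / (1 + α) * c := mul_nonneg (div_nonneg hα0 (by linarith)) hc
  have hσc : σ * c < 1 := by nlinarith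
  have hterm : ∀ n, max 0 (PnY (n + 1) 1 1 - PnX (n + 1) 1 1) ≤ (if Odd n then (α / (1 + α) * c) * c ^ n else 0) := by
    intro n
    rcases Nat.even_or_odd n with he | ho
    · rw [if_neg (Nat.not_odd_iff_even.mpr he)]
      have h := residual_deficit_odd hρX hmonoX hρY hmonoY hagree htag hN hNge hRX hRY hM hPXoff hPXdiag hPYoff hPYdiag hfX hfY hβX hβY ha hPX0 hPXs hPY0 hPYs hTX hTY
        hc hcK hN0 hN1 hm he.add_one
      exact max_le le_rfl h
    · rw [if_pos ho]
      have h := residual_deficit_even hρX hmonoX hρY hmonoY hagree htag hN hNge hRX hRY hM hPXoff hPXdiag hPYoff hPYdiag hfX hfY hβX hβY ha hPX0 hPXs hPY0 hPYs hTX hTY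
        hc hcK hN0 hN1 hm ho.add_one
      refine max_le (mul_nonneg hA (pow_nonneg hc n)) ?_
      calc PnY (n + 1) 1 1 - PnX (n + 1) 1 1 ≤ c ^ (n + 1) * (α / (1 + α)) := h
        _ = α / (1 + α) * c * c ^ n := by rw [pow_succ]; ring
  calc ∑ n ∈ range J, (1 - σ) * σ ^ n * max 0 (PnY (n + 1) 1 1 - PnX (n + 1) 1 1)
      ≤ ∑ n ∈ range J, (1 - σ) * (σ ^ n * (if Odd n then (α / (1 + α) * c) * c ^ n else 0)) := by
        refine sum_le_sum fun n _ => ?_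
        rw [mul_assoc]
        exact mul_le_mul_of_nonneg_left (mul_le_mul_of_nonneg_left (hterm n) (pow_nonneg hσ0 n)) (by linarith)
    _ = (1 - σ) * ∑ n ∈ range J, σ ^ n * (if Odd n then (α / (1 + α) * c) * c ^ n else 0) := by rw [mul_sum]
    _ ≤ (1 - σ) * (α / (1 + α) * c * (σ * c / (1 - (σ * c) ^ 2))) :=
        mul_le_mul_of_nonneg_left (budget_weighted_le hσ0 hc hσc hA J) (by linarith)

end BudgetB

end Summit.Ventures.LatticeQCDFlow.Scaling
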